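import Literature.Computability.AlgebraicComplexity.BI17GenericTernaryQuarticPeriod
import HarnessLib

/-!
# Generic stabilizer periods of forms of even degree `D` in `m` variables, `gcd(D,m) = 1`:
# `a(D,m) = D`, `a'(D,m) = 1` (Bürgisser–Ikenmeyer 2017, Thm. 2.3 AS CORRECTED, an infinite range)

Theorem-only companion (cell `val-lit`, row BI2017-A; no definitions, no named facts) of the file of
record `BI17FundamentalInvariantForms.lean`. P. Bürgisser, C. Ikenmeyer, *Fundamental invariants of
orbit closures*, J. Algebra 477 (2017) = arXiv:1511.02927, Thm. 2.3 (main.tex L473–481): "We have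
`a'(D,m) = 1` except in the following cases: `a'(3,2) = 2`, `a'(3,3) = 2`, `a'(4,3) = 2`" (`D > 2`,
`m ≥ 1`). The verbatim-typed fact `BI2017_thm_2_3_period` is REFUTED in the tree at `(D,m) = (4,3)`
(`not_BI2017_thm_2_3_period`, sibling file `BI17GenericTernaryQuarticPeriod.lean`, erratum A21); the
corrected reading "`a'(D,m) = 1` except `a'(3,2) = a'(3,3) = 2`" rests in print on Matsumura–Monsky
1963 / Poonen 2005 (generic trivial stabilizer), not in the tree.

This file PROVES the corrected statement on the infinite range **`D` even, `D ≥ 2`, `m ≥ 2`,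
`gcd(D,m) = 1`** — e.g. `(4,3)`, `(4,5)`, `(6,5)`, `(8,3)`, `(2k, 2l+1)` coprime — with the sharper
conclusion `det(stab w) = μ_D`, `a(w) = D`, `a'(w) = 1` for every form `w` off the hypersurface
`{P_{D,m} = 0}` (`isZariskiGeneric_period_of_even_of_coprime`), by BI's own invariant-degree mechanism
and without any generic-stabilizer theorem:

* Cayley's `P_{D,m}` (BI eq. (3.5)) is a nonzero `SL_m`-invariant of degree `m` for even `D`
  (BI Thm. 3.18 (2), the tree's `BI2017_thm_3_18_2`), of weight `det^{D·m/m} = det^D` (proof of BI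
  Lemma 3.2 (1), the tree's `IsSLInvariantCoord.aeval_formCoeff_linSubstRep_eq_det_pow`): so
  `det(stab w) ≤ μ_D` whenever `P_{D,m}(w) ≠ 0`;
* the scalars `ζ · 1`, `ζ^D = 1`, lie in every stabilizer with `det = ζ^m`, and `ζ ↦ ζ^m` is onto `μ_D`
  when `gcd(D,m) = 1` (Bezout): `μ_D ≤ det(stab w)`;
* hence `a(w) = |μ_D| = D` and `a'(w) = a(w) · gcd(D,m) / D = 1`.

(For `gcd(D,m) > 1` the same argument only brackets `μ_{D/gcd(D,m)} ≤ det(stab w) ≤ μ_D`; for odd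
`D` the invariant `P_{D,m}` vanishes identically, BI Thm. 3.18 (2).)

Honest framing: bookkeeping of a (corrected) printed statement in the BIP literature programme
(classical invariant theory); nothing here bears on VP versus VNP.

## References

* [BurgisserIkenmeyer2017] P. Bürgisser, C. Ikenmeyer, J. Algebra 477 (2017) 390–434 =
  arXiv:1511.02927, Thm. 2.3 (main.tex L473–481), Lemma 2.1, Lemma 3.2 (1), eq. (3.5), Thm. 3.18 (2).

## Tree

`stabilizerDetImage`, `stabilizerPeriod_def`, `reducedStabilizerPeriod`, `IsZariskiGeneric`,
`slInvariantsOfDegree`, `cayleyP`, `BI2017_thm_3_18_2` (`BI17FundamentalInvariantForms`);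
`cayleyP_mem_slInvariantsOfDegree` (`BI17HoweInvariantsProofs`);
`stabilizerDetImage_le_rootsOfUnity_of_aeval_ne_zero`,
`pow_mem_stabilizerDetImage_of_pow_eq_one` (`BI17GenericTernaryQuarticPeriod`). Mathlib:
`rootsOfUnity`, `mem_rootsOfUnity`, `Complex.card_rootsOfUnity`, `Nat.exists_mul_mod_eq_one_of_coprime`.
-/

noncomputable section

open MvPolynomial

namespace Literature.Computability.AlgebraicComplexity

section EvenCoprime

variable {D m : ℕ}

/-- **`P_{D,m} ≠ 0` for even `D ≥ 2` and `m ≥ 2`** (BI 2017 Thm. 3.18 (2)).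
[cite: BurgisserIkenmeyer2017, Thm. 3.18(2)] -/
theorem cayleyP_ne_zero_of_even (hD : Even D) (hD0 : 0 < D) (hm : 2 ≤ m) :
    cayleyP (k := ℂ) D (Equiv.refl (Fin m)) ≠ 0 :=
  (BI2017_thm_3_18_2 (k := ℂ) hm hD0 (Equiv.refl (Fin m))).mpr hD

/-- **`det(stab w) ≤ μ_D` for every form `w` of even degree `D` with `P_{D,m}(w) ≠ 0`** (weight
`det^{D·m/m} = det^D` of the degree-`m` invariant `P_{D,m}`; `m ≥ 1`).
[cite: BurgisserIkenmeyer2017, Lemma 3.2 (1) (proof)] -/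
theorem stabilizerDetImage_le_rootsOfUnity_of_cayleyP_ne_zero (hm : 0 < m)
    {w : MvPolynomial (Fin m) ℂ} (hw : w.IsHomogeneous D)
    (hP : aeval (formCoeff D w) (cayleyP (k := ℂ) D (Equiv.refl (Fin m))) ≠ 0) :
    stabilizerDetImage w ≤ rootsOfUnity D ℂ :=
  stabilizerDetImage_le_rootsOfUnity_of_aeval_ne_zero hm hw
    (cayleyP_mem_slInvariantsOfDegree (k := ℂ) m D) (Nat.mul_comm D m) hP

/-- **`μ_D ≤ det(stab w)` for every form `w` of degree `D ≥ 2` in `m` variables with `gcd(D,m) = 1`**: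
the scalars `ζ · 1` (`ζ^D = 1`) have `det = ζ^m`, and `ζ ↦ ζ^m` is onto `μ_D` (Bezout). (BI 2017,
proof of Lemma 2.1: `{ζ^m : ζ^D = 1} ≤ det(stab w)` is cyclic of order `D / gcd(D,m)`.)
[cite: BurgisserIkenmeyer2017, Lemma 2.1 (proof)] -/
theorem rootsOfUnity_le_stabilizerDetImage_of_coprime (hD : 1 < D) (hcop : Nat.Coprime D m)
    {w : MvPolynomial (Fin m) ℂ} (hw : w.IsHomogeneous D) :
    rootsOfUnity D ℂ ≤ stabilizerDetImage w := by
  intro u hu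
  rw [mem_rootsOfUnity] at hu
  -- Bezout: `m a ≡ 1 (mod D)`, so `u = (u^a)^m` with `(u^a)^D = 1`
  obtain ⟨a, -, ha⟩ := Nat.exists_mul_mod_eq_one_of_coprime hcop.symm hD
  have hζD : (u ^ a) ^ D = 1 := by rw [← pow_mul, mul_comm, pow_mul, hu, one_pow]
  have hζm : (u ^ a) ^ m = u := by
    rw [← pow_mul, mul_comm, ← Nat.div_add_mod (m * a) D, ha, pow_add, pow_mul, hu, one_pow,
      one_mul, pow_one]
  rw [← hζm]
  exact pow_mem_stabilizerDetImage_of_pow_eq_one hw hζD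

/-- **`det(stab w) = μ_D`** for a form `w` of even degree `D ≥ 2` in `m ≥ 1` variables with
`gcd(D,m) = 1` and `P_{D,m}(w) ≠ 0`. [cite: BurgisserIkenmeyer2017, Thm. 2.3] -/
theorem stabilizerDetImage_eq_rootsOfUnity_of_even_of_coprime (hD : Even D) (hD0 : 0 < D)
    (hm : 0 < m) (hcop : Nat.Coprime D m) {w : MvPolynomial (Fin m) ℂ} (hw : w.IsHomogeneous D)
    (hP : aeval (formCoeff D w) (cayleyP (k := ℂ) D (Equiv.refl (Fin m))) ≠ 0) :
    stabilizerDetImage w = rootsOfUnity D ℂ := by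
  have hD1 : 1 < D := by
    obtain ⟨r, rfl⟩ := hD
    omega
  exact le_antisymm (stabilizerDetImage_le_rootsOfUnity_of_cayleyP_ne_zero hm hw hP)
    (rootsOfUnity_le_stabilizerDetImage_of_coprime hD1 hcop hw)

/-- **`a(w) = D`** for a form `w` of even degree `D ≥ 2` in `m ≥ 1` variables with `gcd(D,m) = 1`
and `P_{D,m}(w) ≠ 0` (`|μ_D| = D`). [cite: BurgisserIkenmeyer2017, Thm. 2.3] -/
theorem stabilizerPeriod_eq_of_even_of_coprime (hD : Even D) (hD0 : 0 < D) (hm : 0 < m)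
    (hcop : Nat.Coprime D m) {w : MvPolynomial (Fin m) ℂ} (hw : w.IsHomogeneous D)
    (hP : aeval (formCoeff D w) (cayleyP (k := ℂ) D (Equiv.refl (Fin m))) ≠ 0) :
    stabilizerPeriod w = D := by
  haveI : NeZero D := ⟨hD0.ne'⟩
  rw [stabilizerPeriod_def, stabilizerDetImage_eq_rootsOfUnity_of_even_of_coprime hD hD0 hm hcop hw hP]
  exact Complex.card_rootsOfUnity D

/-- **`a'(w) = a(w) · gcd(D,m) / D = 1`** under the same hypotheses.
[cite: BurgisserIkenmeyer2017, Thm. 2.3] -/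
theorem reducedStabilizerPeriod_eq_one_of_even_of_coprime (hD : Even D) (hD0 : 0 < D) (hm : 0 < m)
    (hcop : Nat.Coprime D m) {w : MvPolynomial (Fin m) ℂ} (hw : w.IsHomogeneous D)
    (hP : aeval (formCoeff D w) (cayleyP (k := ℂ) D (Equiv.refl (Fin m))) ≠ 0) :
    reducedStabilizerPeriod D w = 1 := by
  rw [reducedStabilizerPeriod, stabilizerPeriod_eq_of_even_of_coprime hD hD0 hm hcop hw hP,
    Fintype.card_fin, Nat.Coprime.gcd_eq_one hcop, mul_one, Nat.div_self hD0]

/-- **BI 2017 Thm. 2.3 AS CORRECTED, on the range `D` even, `m ≥ 2`, `gcd(D,m) = 1`, PROVED**: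
almost all forms `w ∈ Sym^D ℂ^m` have stabilizer period `a(w) = D` and reduced period `a'(w) = 1`
(genericity polynomial `P_{D,m}`). The printed exception "`a'(4,3) = 2`" lies in this range and is
thereby refuted (cf. `not_BI2017_thm_2_3_period`); the remaining printed cases are not affected.
[cite: BurgisserIkenmeyer2017, Thm. 2.3] -/
theorem isZariskiGeneric_period_of_even_of_coprime (hD : Even D) (hD0 : 0 < D) (hm : 2 ≤ m)
    (hcop : Nat.Coprime D m) :
    IsZariskiGeneric D (fun f : MvPolynomial (Fin m) ℂ =>
      stabilizerPeriod f = D ∧ reducedStabilizerPeriod D f = 1) :=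
  ⟨cayleyP (k := ℂ) D (Equiv.refl (Fin m)), cayleyP_ne_zero_of_even hD hD0 hm, fun _ hf hPf =>
    ⟨stabilizerPeriod_eq_of_even_of_coprime hD hD0 (by omega) hcop hf hPf,
      reducedStabilizerPeriod_eq_one_of_even_of_coprime hD hD0 (by omega) hcop hf hPf⟩⟩

/-- **For every even `D` and `m ≥ 2`, almost all `w ∈ Sym^D ℂ^m` have a stabilizer period dividing
`D`** (no coprimality: `det(stab w) ≤ μ_D` off `{P_{D,m} = 0}`; with BI Lemma 2.1 this brackets
`D / gcd(D,m) ∣ a(w) ∣ D`). [cite: BurgisserIkenmeyer2017, Thm. 2.3] -/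
theorem isZariskiGeneric_stabilizerPeriod_dvd_of_even (hD : Even D) (hD0 : 0 < D) (hm : 2 ≤ m) :
    IsZariskiGeneric D (fun f : MvPolynomial (Fin m) ℂ =>
      stabilizerPeriod f ≠ 0 ∧ stabilizerPeriod f ∣ D) := by
  haveI : NeZero D := ⟨hD0.ne'⟩
  refine ⟨cayleyP (k := ℂ) D (Equiv.refl (Fin m)), cayleyP_ne_zero_of_even hD hD0 hm,
    fun f hf hPf => ?_⟩
  have hle := stabilizerDetImage_le_rootsOfUnity_of_cayleyP_ne_zero (by omega) hf hPf
  have hfin : Finite (stabilizerDetImage f) :=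
    Finite.of_injective (Subgroup.inclusion hle) (Subgroup.inclusion_injective hle)
  refine ⟨?_, ?_⟩
  · rw [stabilizerPeriod_def]
    exact Nat.card_pos.ne'
  · rw [stabilizerPeriod_def, ← Complex.card_rootsOfUnity D]
    exact Subgroup.card_dvd_of_le hle

end EvenCoprime

end Literature.Computability.AlgebraicComplexity

end
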